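import Mathlib.Data.Fintype.Basic
import Mathlib.Data.Finset.Card
import Mathlib.Algebra.BigOperators.Group.Finset.Basic
import Mathlib.Algebra.Order.BigOperators.Group.Finset
import Mathlib.Algebra.BigOperators.Group.Finset.Piecewise
import Mathlib.Data.Int.Interval
import Mathlib.Tactic.DeriveFintype
import Mathlib.Tactic.Linarith
import Mathlib.Tactic.Positivity
import Mathlib.Tactic.Ring
import Mathlib.Data.Fintype.Lattice
import Mathlib.Data.Finite.Prod
import Mathlib.Algebra.Order.Group.Defs
import Mathlib.Algebra.Group.Int.Even
import HarnessLib

/-!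
# Barrier: local rules do not force periodicity — finite-range lattice-gas models whose ground
# states exist and are all non-periodic (Wang–Berger tiles in Radin's dictionary)

Topic: `Literature/Barriers/AtomisticToContinuum` (barrier catalogue of
`AtomisticToContinuum/Crystallization`, D-0021; seat 2). Companion of
`SutoDegenerateGroundStates.lean` (continuum, one species, special pair potentials): here the
LATTICE, FINITE-RANGE, FINITELY-MANY-LOCAL-STATES side of the "crystal problem".

## The obstruction, as printed

Radin, *Global order from local sources*, Bull. AMS 24 (1991): the crystal problem, sphere packing
and Wang's tiling game are instances of one optimisation problem — minimise, for all large bounded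
regions `R`, a functional `F_R` built from a short-range translation-invariant interaction (§2,
(5)–(7)); for a set of prototiles "define `F_R(A)` to be the number of those pairs of abutting
tiles in `A` that do not satisfy the color rules, and are also such that at least one of the pair
is contained in the region `R` … we are interested in configurations `A` … for which `F_R(A) = 0`
for all `R`. Berger's example is then a solution of the same type of optimization problem as the
sphere packing problem, but somewhat less ordered since the optimal `A`'s are not lattices" (§2b,
p. 5 of the held copy); the dictionary (7): an `m`-state model on `ℤ²` with nearest-neighbour
interaction `V(A_i, A_j) = -1` if the tiles at `i, j` satisfy the colour rules and `0` otherwise,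
for which "any configuration corresponding to a tiling of the plane will be a ground state
configuration" (§2d, p. 7); "Berger … construct[ed] such a set of prototiles, which can tile the
plane, but only nonperiodically" (§2b, p. 5); in dimension one, for finite range, "every
1 dimensional problem has a periodic ground state" (§3a, p. 9). Miekisz, J. Stat. Phys. 90
(1998), §1–§2: "With one-to-one correspondence between particles and tiles, we simply assign a
positive energy to pairs of nearest-neighbor particles which do not match as tiles; otherwise the
energy of interaction is zero … Ground-state configurations of these models correspond to
tilings"; ground-state configuration: `H^Φ(Y, X) ≥ 0` for every local excitation `Y ∼ X`
(relative Hamiltonian over the finitely many changed terms); "Although, for any given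
Hamiltonian, the set of ground-state configurations is nonempty, it may not contain any periodic
configuration [Radin 1985, 1986; Miekisz–Radin 1986]". Jeandel–Vanier 2020, §1: Wang tiles
`t : {N, S, E, W} → C`, tilings `x : ℤ² → τ` with matching colours on common edges, "periodic if
there exists `p` s.t. `x(i, j) = x(i mod p, j mod p)`", "`τ` tiles the plane, but no periodic
tiling exists. We will say that `τ` is aperiodic"; "the smallest aperiodic tileset has 11 tiles"
(§2.2, p. 7).

## Lean contents (namespace `Literature.StatMech.WangLatticeGas`)

* `WangTile C`, `IsTiling`, `IsPeriodic` (Jeandel–Vanier's `p`-periodicity in both directions),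
  `Berger1966_aperiodicTileset : Prop` — NAMED FACT: an aperiodic tile set exists.
* Radin's / Miekisz's lattice gas: `bondEnergy` (mismatch indicator of a nearest-neighbour bond),
  `relHamiltonian D Y X` (relative Hamiltonian over the bonds meeting the finite set `D` off which
  `Y = X`), `IsGroundStateConfig` (Miekisz §2), and the PROVED half of the dictionary
  `IsTiling.isGroundStateConfig` (tilings are ground-state configurations, Radin §2d).
* `AperiodicTilingGroundStates : Prop` — the barrier: there is a finite colour set and a tile
  set whose mismatch lattice gas HAS ground-state configurations of zero energy and admits NO
  periodic zero-energy configuration; `aperiodicTilingGroundStates_of_berger` derives it from the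
  named fact (zero energy ⟺ tiling, proved).
* `HasZeroEnergy.of_isGroundStateConfig_of_isPeriodic` — PROVED (area versus perimeter, Peierls):
  if a zero-energy configuration exists, every PERIODIC ground-state configuration has zero
  energy; hence `NoPeriodicGroundStateConfig` (ground-state configurations exist, none is
  periodic — Miękisz's sentence) follows from Berger's theorem
  (`noPeriodicGroundStateConfig_of_berger`).
* Scope boundary at range one (barrier audit 2026-08-15, D-0021): the general nearest-neighbour
  pair gas `pairEnergy` / `pairRelHamiltonian` / `IsPairGroundStateConfig` (Radin's problem (5) at
  range one), of which the mismatch gas is the instance `wangInteraction`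
  (`isGroundStateConfig_iff_isPairGroundStateConfig`), and the PROVED evasion
  `exists_isPeriodic_isPairGroundStateConfig_of_symmetric`: a SYMMETRIC, DIRECTION-INDEPENDENT
  nearest-neighbour pair interaction on `ℤ²` always has a periodic (checkerboard) ground-state
  configuration — the tile-set examples need a direction-dependent or non-symmetric coupling, an
  escape that the literature closes again from range `2`–`3` on (fully symmetric finite-range
  models with a unique, stable non-periodic ground state, Miękisz 1997 §4). The `evasions_known:` /
  `scope_caveats:` blocks below record the audited state of the art: uniqueness (non-degeneracy) of
  the ground state, isotropy beyond range one, genericity within nearest-neighbour two-body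
  perturbations, several species in the continuum, and even a single species of rigid bodies
  (aperiodic monotiles) or a single translated cluster in `ℤ^d`, `d` large, do NOT restore
  periodicity; open are full finite-range stability (strict boundary condition) and, untouched by
  every construction, ONE species of point particles with a radial pair potential.

## Sources

* C. Radin, *Global order from local sources*, Bull. Amer. Math. Soc. 24 (1991) 335–364,
  doi:10.1090/S0273-0979-1991-16077-5: §2b (p. 5), §2c–2d (pp. 5–8), §3a (p. 9), §3b–3c (p. 10).
* J. Miękisz, *An ultimate frustration in classical lattice-gas models*, J. Stat. Phys. 90 (1998)
  285–300, arXiv:cond-mat/9706293: abstract, §1 (p. 2), §2 (pp. 3–4, Theorem 1).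
* E. Jeandel, P. Vanier, *The undecidability of the Domino Problem*, in: Substitution and Tiling
  Dynamics, LNM 2273, Springer (2020), doi:10.1007/978-3-030-57666-0_6: §1.1 Definitions 1–2,
  Theorem 1; §1.2 (trichotomy, Theorem 2 (Berger), Theorem 3 (Hanf–Myers)); §2.2 (p. 7).
* R. Berger, *The undecidability of the domino problem*, Mem. AMS 66 (1966) (cited through the
  three sources above; not held).
* J. Miękisz, *Stable quasicrystalline ground states*, J. Stat. Phys. 88 (1997) 691–711,
  arXiv:cond-mat/9301017: §1 (p. 2), §2 Theorem 1 (strict boundary condition ⟺ stability), §3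
  (Robinson's model unstable, after Miękisz–Radin, Phys. Lett. 119A (1986)), §4 Theorems 2–4 and
  the account of Radin's fully symmetric lattice model (Phys. Lett. 114A (1986)), §5.
* D. Głodkowski, J. Miękisz, *On non-stability of one-dimensional non-periodic ground states*,
  J. Stat. Phys. 192 (2024), arXiv:2401.11594: §1 (p. 3).
* A. van Enter, H. Koivusalo, J. Miękisz, *Sturmian ground states in classical lattice-gas
  models*, J. Stat. Phys. 178 (2019/2020), arXiv:1906.12103: §4 (pp. 10–11).
* X. Blanc, M. Lewin, *The crystallization conjecture: a review*, EMS Surv. Math. Sci. 2 (2015),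
  arXiv:1504.01153: §2.3, §3.2.
* D. Smith, J. S. Myers, C. S. Kaplan, C. Goodman-Strauss, *A chiral aperiodic monotile*,
  Combinatorial Theory 4 (2) (2024) #13: abstract and §1.
* R. Greenfeld, T. Tao, *A counterexample to the periodic tiling conjecture*, Ann. of Math. 200
  (2024): abstract.

## Wording risks

* Zero-energy configurations are exactly the tilings (`isTiling_iff_hasZeroEnergy`); that an
  aperiodic tile set has no periodic ground-state configuration AT ALL is proved here by the
  area-versus-perimeter argument (a `p`-periodic configuration with a mismatched bond loses `k²`
  mismatches and gains at most `4kp` when a tiling is pasted into a `kp × kp` box), the finite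
  shadow of "ground-state configurations have minimal energy density" (Miękisz §2).
* `IsPeriodic` is the square-period form printed by Jeandel–Vanier ("all equivalent in our case");
  Radin's "unit cell + lattice of translations" allows any full-rank period lattice — for Wang
  tilings the notions agree (a tile set with a singly periodic tiling has a bi-periodic one), a
  classical fact not needed here since only NON-existence of periodic tilings is asserted.
-/

namespace Literature.Barriers.AtomisticToContinuum.WangLatticeGas

open Finset

/-! ### Wang tiles and tilings (Jeandel–Vanier, Definitions 1–2) -/

/-- A Wang tile over the colour set `C`: a unit square with coloured edges, i.e. a map from the
four sides to `C`; here a structure with fields `north, south, east, west`.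
[cite: JeandelVanier2020, §1.1 Definition 1] -/
structure WangTile (C : Type) where
  /-- colour of the top edge -/
  north : C
  /-- colour of the bottom edge -/
  south : C
  /-- colour of the right edge -/
  east : C
  /-- colour of the left edge -/
  west : C
deriving DecidableEq

variable {C : Type}

/-- A configuration `x : ℤ² → τ` by the tile set `τ` is a **tiling** if colours of adjacent tiles
agree on their common edge: east of `x(i,j)` = west of `x(i+1,j)` and north of `x(i,j)` = south
of `x(i,j+1)`. [cite: JeandelVanier2020, §1.1 Definition 2] -/
def IsTiling {τ : Finset (WangTile C)} (x : ℤ × ℤ → τ) : Prop :=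
  ∀ i j : ℤ, (x (i, j)).1.east = (x (i + 1, j)).1.west ∧ (x (i, j)).1.north = (x (i, j + 1)).1.south

/-- A configuration is **periodic** if for some `p ≥ 1` it is `p`-periodic in both directions
("`x(i, j) = x(i mod p, j mod p)`"; all usual variants are equivalent for Wang tilings).
[cite: JeandelVanier2020, §1.2 (p. 4)] -/
def IsPeriodic {α : Type} (x : ℤ × ℤ → α) : Prop :=
  ∃ p : ℤ, 0 < p ∧ ∀ i j : ℤ, x (i + p, j) = x (i, j) ∧ x (i, j + p) = x (i, j)

/-- NAMED FACT — **Berger 1966: an aperiodic tile set exists.** There are a finite colour set and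
a (finite) set `τ` of Wang tiles such that `τ` tiles the plane but admits no periodic tiling
("`τ` tiles the plane, but no periodic tiling exists. We will say that `τ` is aperiodic";
Berger's construction, refined by Robinson; the smallest such set has `11` tiles).
[cite: JeandelVanier2020, §1.2 (trichotomy and Theorem 2) and §2.2 (p. 7)]
[cite: Radin1991, §2b (p. 5: "Berger … construct[ed] such a set of prototiles, which can tile the plane, but only nonperiodically")] -/
def Berger1966_aperiodicTileset : Prop :=
  ∃ (C : Type) (_ : Fintype C) (τ : Finset (WangTile C)),
    (∃ x : ℤ × ℤ → τ, IsTiling x) ∧ ∀ x : ℤ × ℤ → τ, IsTiling x → ¬ IsPeriodic x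

/-! ### Radin's dictionary: the mismatch lattice gas (Radin (7); Miękisz §2) -/

/-- The two lattice directions of nearest-neighbour bonds. [folklore] -/
inductive Dir where
  | horiz
  | vert
deriving DecidableEq, Fintype

/-- The far endpoint of the bond at `p` in direction `d`. [folklore] -/
def Dir.shift : Dir → ℤ × ℤ → ℤ × ℤ
  | .horiz, p => (p.1 + 1, p.2)
  | .vert, p => (p.1, p.2 + 1)

/-- **The nearest-neighbour mismatch interaction** of the tile set (Radin's (7) shifted by the
constant `+1`, as in Miękisz: "a positive energy to pairs of nearest-neighbor particles which do
not match as tiles; otherwise the energy of interaction is zero"): the energy of the bond from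
`p` to `p + e_d` in the configuration `x` is `1` if the two tiles mismatch along it, else `0`.
[cite: Miekisz1998, abstract and §1 (p. 2)] [cite: Radin1991, §2d (7)] -/
def bondEnergy {τ : Finset (WangTile C)} [DecidableEq C] (x : ℤ × ℤ → τ) (d : Dir) (p : ℤ × ℤ) : ℕ :=
  match d with
  | .horiz => if (x p).1.east = (x (d.shift p)).1.west then 0 else 1
  | .vert => if (x p).1.north = (x (d.shift p)).1.south then 0 else 1

/-- The bonds meeting a finite set `D` of sites: pairs `(d, p)` (the bond `{p, p + e_d}`) with
`p ∈ D` or `p + e_d ∈ D`. [folklore] -/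
def bondsMeeting (D : Finset (ℤ × ℤ)) : Finset (Dir × (ℤ × ℤ)) :=
  (Finset.univ ×ˢ (D ∪ D.image (fun p => (p.1 - 1, p.2)) ∪ D.image (fun p => (p.1, p.2 - 1)))).filter
    fun b => b.2 ∈ D ∨ b.1.shift b.2 ∈ D

/-- A bond meets `D` iff it is listed in `bondsMeeting D`. [folklore] -/
theorem mem_bondsMeeting {D : Finset (ℤ × ℤ)} {d : Dir} {p : ℤ × ℤ} :
    (d, p) ∈ bondsMeeting D ↔ p ∈ D ∨ d.shift p ∈ D := by
  unfold bondsMeeting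
  simp only [Finset.mem_filter, Finset.mem_product, Finset.mem_univ, true_and, Finset.mem_union,
    Finset.mem_image, and_iff_right_iff_imp]
  rintro (h | h)
  · exact Or.inl (Or.inl h)
  · cases d with
    | horiz => exact Or.inl (Or.inr ⟨_, h, by simp [Dir.shift]⟩)
    | vert => exact Or.inr ⟨_, h, by simp [Dir.shift]⟩

/-- **The relative Hamiltonian** `H^Φ(Y, X) = ∑_Λ (Φ_Λ(Y) - Φ_Λ(X))` of a local excitation `Y`
of `X` that agrees with `X` off the finite set `D`: only the bonds meeting `D` contribute, and the
sum is taken over them (Miękisz §2: "for finite-range potentials, there are only a finite number of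
nonzero terms"). [cite: Miekisz1998, §2 (p. 3)] -/
def relHamiltonian {τ : Finset (WangTile C)} [DecidableEq C] (D : Finset (ℤ × ℤ))
    (y x : ℤ × ℤ → τ) : ℤ :=
  ∑ b ∈ bondsMeeting D, ((bondEnergy y b.1 b.2 : ℤ) - (bondEnergy x b.1 b.2 : ℤ))

/-- **Ground-state configuration** (Miękisz §2): `X` is a ground-state configuration if
`H^Φ(Y, X) ≥ 0` for every local excitation `Y ∼ X`, "i.e., one cannot lower the energy of a
ground-state configuration by its local change (on a finite subset of lattice sites)".
[cite: Miekisz1998, §2 (p. 3)] -/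
def IsGroundStateConfig {τ : Finset (WangTile C)} [DecidableEq C] (x : ℤ × ℤ → τ) : Prop :=
  ∀ (D : Finset (ℤ × ℤ)) (y : ℤ × ℤ → τ), (∀ p ∉ D, y p = x p) → 0 ≤ relHamiltonian D y x

/-- A configuration has **zero energy** if every bond matches (Radin: "`F_R(A) = 0` for all `R`";
Miękisz: a configuration "minimizing simultaneously all interactions", non-frustration).
[cite: Radin1991, §2b (p. 5)] [cite: Miekisz1998, §2 (m-potential)] -/
def HasZeroEnergy {τ : Finset (WangTile C)} [DecidableEq C] (x : ℤ × ℤ → τ) : Prop :=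
  ∀ (d : Dir) (p : ℤ × ℤ), bondEnergy x d p = 0

/-- **Zero energy ⟺ tiling** ("one-to-one correspondence between such ground-state configurations
and tilings of the plane"). [cite: Miekisz1998, §1 (p. 2)] [cite: Radin1991, §2d (p. 7)] -/
theorem isTiling_iff_hasZeroEnergy {τ : Finset (WangTile C)} [DecidableEq C] (x : ℤ × ℤ → τ) :
    IsTiling x ↔ HasZeroEnergy x := by
  constructor
  · intro h d p
    obtain ⟨h1, h2⟩ := h p.1 p.2
    cases d with
    | horiz => simp [bondEnergy, Dir.shift, h1]
    | vert => simp [bondEnergy, Dir.shift, h2]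
  · intro h i j
    have h1 := h .horiz (i, j)
    have h2 := h .vert (i, j)
    simp only [bondEnergy, Dir.shift] at h1 h2
    exact ⟨by by_contra hc; simp [hc] at h1, by by_contra hc; simp [hc] at h2⟩

/-- **Tilings are ground-state configurations** of the mismatch lattice gas ("any configuration
corresponding to a tiling of the plane will be a ground state configuration"): all its bond
energies vanish, so no local change can lower the relative Hamiltonian.
[cite: Radin1991, §2d (p. 7)] [cite: Miekisz1998, §2 ("Such a configuration is of course a ground-state configuration")] -/
theorem HasZeroEnergy.isGroundStateConfig {τ : Finset (WangTile C)} [DecidableEq C]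
    {x : ℤ × ℤ → τ} (h : HasZeroEnergy x) : IsGroundStateConfig x := by
  intro D y _
  unfold relHamiltonian
  refine Finset.sum_nonneg fun b _ => ?_
  rw [h b.1 b.2]
  simp

/-- Tilings are ground-state configurations. [cite: Radin1991, §2d (p. 7)] -/
theorem IsTiling.isGroundStateConfig {τ : Finset (WangTile C)} [DecidableEq C] {x : ℤ × ℤ → τ}
    (h : IsTiling x) : IsGroundStateConfig x :=
  ((isTiling_iff_hasZeroEnergy x).1 h).isGroundStateConfig

/-! ### The barrier -/

/-- **BARRIER (AtomisticToContinuum / Crystallization): local rules do not force periodicity —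
a nearest-neighbour, finitely-many-state, translation-invariant lattice model on `ℤ²` whose
zero-energy (ground-state) configurations exist and are all non-periodic.** The technique
class stopped: model-generic "order from local optimality" arguments — derivations of periodicity
of energy-minimising configurations that use only finite range, translation invariance and
finitely many local states of the interaction (Radin's general optimisation problem (5)–(7), of
which "the crystal problem", sphere packing and the tiling game are instances)
[cite: Radin1991, §2c–2d (pp. 5–8)] [cite: Miekisz1998, §1 (p. 2: "the so-called crystal problem … to understand why ground-state configurations should have a perfect periodic order")].

* technique_class: model-generic local-rules-force-periodicity local-optimality-implies-order finite-range-lattice-gas nearest-neighbour-matching finitely-many-local-states translation-invariance-only ground-state-periodicity-generic crystal-problem-generic tiling-dictionary unique-ground-state-implies-periodicity isotropic-multispecies-finite-range nearest-neighbour-two-body-genericity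
* blocks: the natural generic strengthening of `AtomisticToContinuum/Crystallization`, "ground states of short-range translation-invariant interactions are periodic", already for nearest-neighbour lattice gases in `d = 2`: "Berger's example is then a solution of the same type of optimization problem as the sphere packing problem, but somewhat less ordered since the optimal A's are not lattices" [cite: Radin1991, §2b (p. 5)]; "for any given Hamiltonian, the set of ground-state configurations is nonempty, it may not contain any periodic configuration" [cite: Miekisz1998, §2 (p. 3, citing Radin 1985, 1986, Miękisz–Radin 1986)]
* because: Wang's dictionary tiles ↦ `m`-state nearest-neighbour model with energy `0` on matching and a penalty on mismatching abutting pairs [cite: Radin1991, §2d (7)] [cite: Miekisz1998, §2 Theorem 1] makes tilings exactly the zero-energy configurations (this file, `isTiling_iff_hasZeroEnergy`), which are ground-state configurations (`IsTiling.isGroundStateConfig`); and Berger constructed "a set of prototiles, which can tile the plane, but only nonperiodically" [cite: Radin1991, §2b (p. 5)] [cite: JeandelVanier2020, §1.2]; worse examples exist: tile sets all of whose tilings are non-recursive (Hanf–Myers) [cite: JeandelVanier2020, §1.2 Theorem 3] [cite: Radin1991, §3c (p. 10)], and uncountably many frustrated finite-range models with unique non-periodic ground states not of finite type [cite: Miekisz1998,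 abstract and §1]
* evasions_known: (i) `d = 1`: for finite-range interactions "every 1 dimensional problem has a periodic ground state" [cite: Radin1991, §3a (p. 9)]; (ii) few local states: a set of at most `10` Wang tiles that tiles the plane tiles it periodically ("the smallest aperiodic tileset has 11 tiles", Jeandel–Rao) [cite: JeandelVanier2020, §2.2 (p. 7)]; (iii) range one with a SYMMETRIC, DIRECTION-INDEPENDENT pair coupling (identical unlabelled isotropic particles): the checkerboard of a minimising pair is a periodic ground-state configuration for every finite state space (`exists_isPeriodic_isPairGroundStateConfig_of_symmetric`, this file) — an escape that closes from range `2`–`3` on: Radin's lattice model with "shapeless" particles and "fully symmetric (dependent only on the distance between given particles)" finite-range interactions has a unique non-periodic ground state, stable under symmetric perturbations of range `< 3` [cite: Miekisz1997, §4 (Theorem 4, citing Radin, Phys. Lett. 114A (1986))]; (iv) weaker notions of order survive: in Radin's framework the set of ground-state configurations is taken uniquely (indeed strictly) ergodic [cite: Radin1991, §2d (p. 7) and §3a (p. 9)] and for finite range its entropy is then zero (Theorem 2, third law; "for finite range V we found that the entropy was always zero") [cite: Radin1991, §3b (p. 10) and §3e] — without uniqueness this fails (a tile set times a free two-colouring has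 only non-periodic tilings and entropy `log 2`); non-periodic tilings are expected to have pure point (quasicrystalline) spectrum [cite: Radin1991, §3d (p. 11)]; (v) potential-specific, ONE-SPECIES analysis of point particles with a radial pair potential — the Lennard-Jones conjunct; the proved cases (sticky and soft discs, Theil's potentials in `d = 2`) "rely heavily on the similarity with the sphere packing" [cite: BlancLewin2015, §2.3] — is the only class no construction below touches. NOT evasions (closed by the literature; audit 2026-08-15): (a) non-degeneracy / unique ergodicity of the ground state — "there are examples of tiling systems with unique measures supported by nonperiodic tilings" (Robinson, Mozes) [cite: Miekisz1998, §2 (p. 3)], and finite-range models with a UNIQUE non-periodic ground-state measure [cite: Miekisz1997, §4 (Proposition 1, Theorems 2–3)]; (b) genericity within chemical-potential and nearest-neighbour two-body perturbations — "there is an open set in a space of two-body interactions without periodic ground-state configurations. This constitutes a first generic counterexample to the crystal problem" [cite: Miekisz1997, §1 (p. 2) and §4 (Theorems 2–4)] (Robinson's unmodified model IS unstable under arbitrarily small chemical potentials, Miękisz–Radin 1986 [cite: Miekisz1997, §3]); (c) several species of point particles in the CONTINUUM with short-range isotropic potentials: "Radin considers special short-range potentials for two types of particles, and proves that crystallization fails,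 but the minimizers are quasi-periodic" (Comm. Math. Phys. 105 (1986)) [cite: BlancLewin2015, §3.2]; (d) a single species of rigid bodies: the Spectre is a strictly chiral aperiodic monotile — one shape whose tilings of `ℝ²` by translations and rotations exist and are all non-periodic [cite: SmithMyersKaplanGoodmanStrauss2024, abstract and §1]; (e) a single finite cluster translated in `ℤ^d`, `d` large (one species, hard-core pair exclusion at the tiling density): it tiles, but only non-periodically [cite: GreenfeldTao2024, abstract]. OPEN: stability under arbitrary finite-range (many-body) perturbations ⟺ the strict boundary condition for all local patterns [cite: Miekisz1997, §2 (Theorem 1)]; "so far we do not have examples of two-dimensional finite-range classical lattice-gas models without periodic ground-state configurations which satisfy the strict boundary condition" [cite: GlodkowskiMiekisz2024, §1 (p. 3)]; positive temperature (non-periodic Gibbs states) is conjecturally governed by the same condition [cite: VanenterKoivusaloMiekisz2019, §4 (p. 11)]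
* scope_caveats: the formalised examples are LATTICE models on `ℤ²` with several particle types (one per prototile; `≥ 11` for Wang tiles [cite: JeandelVanier2020, §2.2 (p. 7)]) and a direction-dependent, non-symmetric nearest-neighbour coupling (`wangInteraction`; necessarily so at range one, `exists_isPeriodic_isPairGroundStateConfig_of_symmetric`); by the literature recorded under `evasions_known` (a)–(e) the obstruction persists for unique ground states, fully symmetric finite-range couplings, open sets of nearest-neighbour two-body interactions, several species in the continuum and one species of rigid bodies, so the residual gap to the Lennard-Jones conjunct is exactly: ONE species of POINT particles, RADIAL pair potential, `d = 3` [cite: BlancLewin2015, §2.3 and §3.2]; nothing is implied about Lennard-Jones; formalised: Wang tiles, Miękisz's ground-state configurations, the zero-energy ⟺ tiling dictionary, the exclusion of periodic ground-state configurations with defects (`HasZeroEnergy.of_isGroundStateConfig_of_isPeriodic`, so that `NoPeriodicGroundStateConfig` below is the full printed sentence [cite: Miekisz1998, §2 (p. 3)]), the reduction from Berger's theorem (discharged in the companion `AperiodicTilingGroundStatesProofs` by Kari's tiles) and the range-one evasion; NOT formalised: stability / strict boundary condition, entropy, the continuum and monotile examples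
* status: established (Berger 1966; Robinson 1971; four independent proofs of the undecidability of the domino problem [cite: JeandelVanier2020, §3 (p. 9)]; Radin's dictionary [cite: Radin1991, §2d]); proved in the tree (`aperiodicTilingGroundStates_holds`, companion file); audited 2026-08-15 (confirmed; evasions corrected)

[cite: Radin1991, §2b (p. 5) and §2d (p. 7)] [cite: Miekisz1998, §1–§2] -/
def AperiodicTilingGroundStates : Prop :=
  ∃ (C : Type) (_ : Fintype C) (_ : DecidableEq C) (τ : Finset (WangTile C)),
    (∃ x : ℤ × ℤ → τ, HasZeroEnergy x ∧ IsGroundStateConfig x) ∧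
      ∀ x : ℤ × ℤ → τ, HasZeroEnergy x → ¬ IsPeriodic x

/-- **Reduction**: Berger's aperiodic tile set gives the barrier (Radin's dictionary).
[cite: Radin1991, §2b (p. 5) and §2d (p. 7)] -/
theorem aperiodicTilingGroundStates_of_berger (h : Berger1966_aperiodicTileset) :
    AperiodicTilingGroundStates := by
  obtain ⟨C, hC, τ, ⟨x, hx⟩, hτ⟩ := h
  classical
  refine ⟨C, hC, inferInstance, τ, ⟨x, (isTiling_iff_hasZeroEnergy x).1 hx, hx.isGroundStateConfig⟩,
    fun y hy => hτ y ((isTiling_iff_hasZeroEnergy y).2 hy)⟩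

/-- Conversely the barrier returns an aperiodic tile set: the two statements are equivalent forms
of Berger's theorem. [cite: Radin1991, §2d (p. 7)] -/
theorem berger_of_aperiodicTilingGroundStates (h : AperiodicTilingGroundStates) :
    Berger1966_aperiodicTileset := by
  obtain ⟨C, hC, hD, τ, ⟨x, hx, -⟩, hτ⟩ := h
  refine ⟨C, hC, τ, ⟨x, ?_⟩, fun y hy => hτ y ?_⟩
  · exact (isTiling_iff_hasZeroEnergy x).2 (by convert hx)
  · convert (isTiling_iff_hasZeroEnergy y).1 hy

/-! ### Peierls: periodic ground-state configurations have zero energy (if tilings exist) -/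

section Peierls

variable {τ : Finset (WangTile C)} [DecidableEq C]

/-- Bond energies are `0` or `1`. [folklore] -/
theorem bondEnergy_le_one (x : ℤ × ℤ → τ) (d : Dir) (p : ℤ × ℤ) : bondEnergy x d p ≤ 1 := by
  cases d <;> simp only [bondEnergy] <;> split <;> simp

/-- The bond energy depends only on the tiles at the two endpoints. [folklore] -/
theorem bondEnergy_congr₂ {x x' : ℤ × ℤ → τ} {d : Dir} {q q' : ℤ × ℤ} (h1 : x q = x' q')
    (h2 : x (d.shift q) = x' (d.shift q')) : bondEnergy x d q = bondEnergy x' d q' := by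
  cases d <;> simp only [bondEnergy, h1, h2]

/-- Iterated horizontal periods. [folklore] -/
theorem periodic_horiz {α : Type} {p : ℤ} {x : ℤ × ℤ → α}
    (hper : ∀ i j, x (i + p, j) = x (i, j) ∧ x (i, j + p) = x (i, j)) (a : ℕ) (i j : ℤ) :
    x (i + a * p, j) = x (i, j) := by
  induction a with
  | zero => simp
  | succ n ih =>
    have h := (hper (i + n * p) j).1
    push_cast
    rw [show i + (↑n + 1) * p = i + n * p + p by ring, h, ih]

/-- Iterated vertical periods. [folklore] -/
theorem periodic_vert {α : Type} {p : ℤ} {x : ℤ × ℤ → α}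
    (hper : ∀ i j, x (i + p, j) = x (i, j) ∧ x (i, j + p) = x (i, j)) (b : ℕ) (i j : ℤ) :
    x (i, j + b * p) = x (i, j) := by
  induction b with
  | zero => simp
  | succ n ih =>
    have h := (hper i (j + n * p)).2
    push_cast
    rw [show j + (↑n + 1) * p = j + n * p + p by ring, h, ih]

/-- Bond energies of a periodic configuration are periodic. [folklore] -/
theorem bondEnergy_periodic {p : ℤ} {x : ℤ × ℤ → τ}
    (hper : ∀ i j, x (i + p, j) = x (i, j) ∧ x (i, j + p) = x (i, j)) (d : Dir) (a b : ℕ)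
    (q : ℤ × ℤ) : bondEnergy x d (q.1 + a * p, q.2 + b * p) = bondEnergy x d q := by
  have key : ∀ i j : ℤ, x (i + a * p, j + b * p) = x (i, j) := fun i j => by
    rw [periodic_horiz hper, periodic_vert hper]
  refine bondEnergy_congr₂ (key _ _) ?_
  cases d with
  | horiz =>
    show x (q.1 + a * p + 1, q.2 + b * p) = x (q.1 + 1, q.2)
    rw [show q.1 + a * p + 1 = (q.1 + 1) + a * p by ring]
    exact key _ _
  | vert =>
    show x (q.1 + a * p, q.2 + b * p + 1) = x (q.1, q.2 + 1)
    rw [show q.2 + b * p + 1 = (q.2 + 1) + b * p by ring]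
    exact key _ _

/-- **Periodic ground-state configurations have zero energy, as soon as a zero-energy
configuration exists** (area versus perimeter: paste a tiling into a `kp × kp` box of a
`p`-periodic configuration with a mismatched bond; the `≥ k²` removed mismatches beat the `≤ 4kp`
new boundary mismatches once `k > 4p`). This is the mechanism behind "if `X` is a ground-state
configuration, then `X` has the minimal energy density". [cite: Miekisz1998, §2 (p. 3)] -/
theorem HasZeroEnergy.of_isGroundStateConfig_of_isPeriodic {t x : ℤ × ℤ → τ}
    (ht : HasZeroEnergy t) (hx : IsGroundStateConfig x) (hxp : IsPeriodic x) : HasZeroEnergy x := by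
  classical
  by_contra hne
  obtain ⟨d₀, p₀, h0⟩ : ∃ d p, bondEnergy x d p ≠ 0 := by
    simpa [HasZeroEnergy] using hne
  have h1 : bondEnergy x d₀ p₀ = 1 :=
    le_antisymm (bondEnergy_le_one x d₀ p₀) (Nat.one_le_iff_ne_zero.2 h0)
  obtain ⟨p, hp, hper⟩ := hxp
  -- sizes: `k = 4p + 1` cells of side `p`, box side `L = kp`
  set k : ℕ := (4 * p + 1).toNat with hk
  have hkZ : (k : ℤ) = 4 * p + 1 := by rw [hk, Int.toNat_of_nonneg (by omega)]
  set L : ℤ := k * p with hL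
  have hL0 : 0 ≤ L := by rw [hL]; positivity
  -- the box `D` with corner `p₀`
  set D : Finset (ℤ × ℤ) := Finset.Ico p₀.1 (p₀.1 + L) ×ˢ Finset.Ico p₀.2 (p₀.2 + L) with hD
  have memD : ∀ i j : ℤ, (i, j) ∈ D ↔ (p₀.1 ≤ i ∧ i < p₀.1 + L) ∧ (p₀.2 ≤ j ∧ j < p₀.2 + L) := by
    intro i j; simp [hD, Finset.mem_product, Finset.mem_Ico]
  -- the local excitation: the zero-energy configuration inside the box
  set y : ℤ × ℤ → τ := fun q => if q ∈ D then t q else x q with hy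
  have hyD : ∀ q ∈ D, y q = t q := fun q hq => by simp [hy, hq]
  have hyD' : ∀ q ∉ D, y q = x q := fun q hq => by simp [hy, hq]
  have hGS := hx D y hyD'
  -- (1) the boundary bonds `S` (at most `4L` of them) carry all the energy of `y` near `D`
  set S : Finset (Dir × (ℤ × ℤ)) :=
    (Finset.Ico p₀.2 (p₀.2 + L)).image (fun j => (Dir.horiz, (p₀.1 + L - 1, j))) ∪
    (Finset.Ico p₀.2 (p₀.2 + L)).image (fun j => (Dir.horiz, (p₀.1 - 1, j))) ∪
    (Finset.Ico p₀.1 (p₀.1 + L)).image (fun i => (Dir.vert, (i, p₀.2 + L - 1))) ∪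
    (Finset.Ico p₀.1 (p₀.1 + L)).image (fun i => (Dir.vert, (i, p₀.2 - 1))) with hS
  have memS₁ : ∀ i j, p₀.2 ≤ j → j < p₀.2 + L → i = p₀.1 + L - 1 → (Dir.horiz, (i, j)) ∈ S := by
    intro i j hj1 hj2 hi; rw [hS]; subst hi
    exact Finset.mem_union_left _ (Finset.mem_union_left _ (Finset.mem_union_left _
      (Finset.mem_image.2 ⟨j, Finset.mem_Ico.2 ⟨hj1, hj2⟩, rfl⟩)))
  have memS₂ : ∀ i j, p₀.2 ≤ j → j < p₀.2 + L → i = p₀.1 - 1 → (Dir.horiz, (i, j)) ∈ S := by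
    intro i j hj1 hj2 hi; rw [hS]; subst hi
    exact Finset.mem_union_left _ (Finset.mem_union_left _ (Finset.mem_union_right _
      (Finset.mem_image.2 ⟨j, Finset.mem_Ico.2 ⟨hj1, hj2⟩, rfl⟩)))
  have memS₃ : ∀ i j, p₀.1 ≤ i → i < p₀.1 + L → j = p₀.2 + L - 1 → (Dir.vert, (i, j)) ∈ S := by
    intro i j hi1 hi2 hj; rw [hS]; subst hj
    exact Finset.mem_union_left _ (Finset.mem_union_right _
      (Finset.mem_image.2 ⟨i, Finset.mem_Ico.2 ⟨hi1, hi2⟩, rfl⟩))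
  have memS₄ : ∀ i j, p₀.1 ≤ i → i < p₀.1 + L → j = p₀.2 - 1 → (Dir.vert, (i, j)) ∈ S := by
    intro i j hi1 hi2 hj; rw [hS]; subst hj
    exact Finset.mem_union_right _ (Finset.mem_image.2 ⟨i, Finset.mem_Ico.2 ⟨hi1, hi2⟩, rfl⟩)
  have hIco : ∀ a : ℤ, (Finset.Ico a (a + L)).card = L.toNat := fun a => by
    rw [Int.card_Ico]; congr 1; ring
  have hS4 : S.card ≤ L.toNat + L.toNat + L.toNat + L.toNat := by
    rw [hS]
    refine (Finset.card_union_le _ _).trans (add_le_add ((Finset.card_union_le _ _).trans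
      (add_le_add ((Finset.card_union_le _ _).trans (add_le_add ?_ ?_)) ?_)) ?_)
    all_goals exact Finset.card_image_le.trans (hIco _).le
  have hScard : (S.card : ℤ) ≤ 4 * L := by
    have hLn : ((L.toNat : ℕ) : ℤ) = L := Int.toNat_of_nonneg hL0
    calc (S.card : ℤ) ≤ ((L.toNat + L.toNat + L.toNat + L.toNat : ℕ) : ℤ) := by exact_mod_cast hS4
      _ = 4 * L := by push_cast; rw [hLn]; ring
  have hy_bound : ∀ b ∈ bondsMeeting D, (bondEnergy y b.1 b.2 : ℤ) ≤ if b ∈ S then 1 else 0 := by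
    rintro ⟨d, q⟩ hb
    rw [mem_bondsMeeting] at hb
    by_cases hin : q ∈ D ∧ d.shift q ∈ D
    · -- interior bond: it carries the energy of the zero-energy configuration
      have h0 : bondEnergy y d q = 0 := by
        rw [bondEnergy_congr₂ (x' := t) (hyD q hin.1) (hyD _ hin.2)]; exact ht d q
      rw [h0]; split <;> simp
    · -- boundary bond: it lies in `S`
      have hmem : (d, q) ∈ S := by
        obtain ⟨i, j⟩ := q
        have hq := memD i j
        cases d with
        | horiz =>
          have hs := memD (i + 1) j
          simp only [Dir.shift] at hb hin
          rw [hq, hs] at hb hin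
          rcases hb with hb | hb
          · exact memS₁ i j hb.2.1 hb.2.2 (by omega)
          · exact memS₂ i j hb.2.1 hb.2.2 (by omega)
        | vert =>
          have hs := memD i (j + 1)
          simp only [Dir.shift] at hb hin
          rw [hq, hs] at hb hin
          rcases hb with hb | hb
          · exact memS₃ i j hb.1.1 hb.1.2 (by omega)
          · exact memS₄ i j hb.1.1 hb.1.2 (by omega)
      simp only [hmem, if_true]
      exact_mod_cast bondEnergy_le_one y d q
  have hsum_y : ∑ b ∈ bondsMeeting D, (bondEnergy y b.1 b.2 : ℤ) ≤ 4 * L := by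
    refine (Finset.sum_le_sum hy_bound).trans ?_
    rw [Finset.sum_ite_mem]
    refine le_trans ?_ hScard
    simp only [Finset.sum_const, nsmul_eq_mul, mul_one]
    exact_mod_cast Finset.card_le_card Finset.inter_subset_right
  -- (2) `x` has at least `k²` mismatched bonds meeting `D`: the translates of the bad bond
  set T : Finset (Dir × (ℤ × ℤ)) :=
    (Finset.range k ×ˢ Finset.range k).image
      (fun ab : ℕ × ℕ => (d₀, (p₀.1 + ab.1 * p, p₀.2 + ab.2 * p))) with hT
  have hTsub : T ⊆ bondsMeeting D := by
    intro b hb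
    rw [hT, Finset.mem_image] at hb
    obtain ⟨⟨a, c⟩, hac, rfl⟩ := hb
    rw [Finset.mem_product, Finset.mem_range, Finset.mem_range] at hac
    rw [mem_bondsMeeting]
    left
    rw [memD]
    have ha : (a : ℤ) * p < L := by
      rw [hL]; exact mul_lt_mul_of_pos_right (by exact_mod_cast hac.1) hp
    have hc : (c : ℤ) * p < L := by
      rw [hL]; exact mul_lt_mul_of_pos_right (by exact_mod_cast hac.2) hp
    have ha0 : 0 ≤ (a : ℤ) * p := by positivity
    have hc0 : 0 ≤ (c : ℤ) * p := by positivity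
    exact ⟨⟨by linarith, by linarith⟩, ⟨by linarith, by linarith⟩⟩
  have hTinj : Function.Injective (fun ab : ℕ × ℕ => (d₀, (p₀.1 + ab.1 * p, p₀.2 + ab.2 * p))) := by
    rintro ⟨a, c⟩ ⟨a', c'⟩ h
    simp only [Prod.mk.injEq, true_and] at h
    obtain ⟨h1', h2'⟩ := h
    have ha : (a : ℤ) = a' := mul_right_cancel₀ hp.ne' (by linarith)
    have hc : (c : ℤ) = c' := mul_right_cancel₀ hp.ne' (by linarith)
    exact Prod.ext (by exact_mod_cast ha) (by exact_mod_cast hc)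
  have hTcard : (T.card : ℤ) = (k : ℤ) ^ 2 := by
    rw [hT, Finset.card_image_of_injective _ hTinj, Finset.card_product, Finset.card_range]
    push_cast; ring
  have hTone : ∀ b ∈ T, (bondEnergy x b.1 b.2 : ℤ) = 1 := by
    intro b hb
    rw [hT, Finset.mem_image] at hb
    obtain ⟨⟨a, c⟩, -, rfl⟩ := hb
    show (bondEnergy x d₀ (p₀.1 + a * p, p₀.2 + c * p) : ℤ) = 1
    rw [bondEnergy_periodic hper d₀ a c p₀, h1]
    simp
  have hsum_x : (k : ℤ) ^ 2 ≤ ∑ b ∈ bondsMeeting D, (bondEnergy x b.1 b.2 : ℤ) := by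
    calc (k : ℤ) ^ 2 = ∑ b ∈ T, (bondEnergy x b.1 b.2 : ℤ) := by
          rw [Finset.sum_congr rfl hTone]; simp [hTcard]
      _ ≤ _ := Finset.sum_le_sum_of_subset_of_nonneg hTsub fun _ _ _ => by positivity
  -- (3) the relative Hamiltonian is negative: contradiction with the ground-state property
  have hrel : relHamiltonian D y x =
      ∑ b ∈ bondsMeeting D, (bondEnergy y b.1 b.2 : ℤ) -
        ∑ b ∈ bondsMeeting D, (bondEnergy x b.1 b.2 : ℤ) :=
    Finset.sum_sub_distrib _ _
  rw [hrel] at hGS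
  have hk2 : (k : ℤ) ^ 2 ≤ 4 * L := by linarith
  rw [hL, hkZ] at hk2
  nlinarith

end Peierls

/-! ### The strengthened barrier: no periodic ground-state configuration at all -/

/-- **BARRIER, strengthened form (Miękisz's sentence): a nearest-neighbour finite-state lattice
gas on `ℤ²` whose set of ground-state configurations is non-empty and contains NO periodic
configuration** — "for any given Hamiltonian, the set of ground-state configurations is nonempty,
it may not contain any periodic configuration".

* technique_class: model-generic local-rules-force-periodicity local-optimality-implies-order finite-range-lattice-gas nearest-neighbour-matching finitely-many-local-states translation-invariance-only ground-state-periodicity-generic crystal-problem-generic tiling-dictionary unique-ground-state-implies-periodicity isotropic-multispecies-finite-range nearest-neighbour-two-body-genericity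
* blocks: as `AperiodicTilingGroundStates` — the generic strengthening "ground states of short-range translation-invariant interactions are periodic", now for ALL ground-state configurations of the model [cite: Miekisz1998, §2 (p. 3)]
* because: as `AperiodicTilingGroundStates`, plus the area-versus-perimeter exclusion of periodic ground-state configurations with defects (`HasZeroEnergy.of_isGroundStateConfig_of_isPeriodic`, this file) [cite: Radin1991, §2d (p. 7: fault lines are ground states but not tilings)]
* evasions_known: as `AperiodicTilingGroundStates` (items (i)–(v); (a)–(e) are NOT evasions; full finite-range stability open) [cite: Radin1991, §3a (p. 9)] [cite: Miekisz1997, §1 (p. 2) and §4] [cite: GlodkowskiMiekisz2024, §1 (p. 3)]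
* scope_caveats: as `AperiodicTilingGroundStates`; Berger's theorem (`noPeriodicGroundStateConfig_of_berger`) is discharged in the companion file by Kari's tiles [cite: JeandelVanier2020, §1.2 and §5.3]; for symmetric direction-independent range-one couplings the conclusion fails (`not_forall_groundState_aperiodic_of_symmetric`)
* status: established [cite: JeandelVanier2020, §3 (p. 9)]

[cite: Miekisz1998, §2 (p. 3)] [cite: Radin1991, §2b (p. 5) and §2d (p. 7)] -/
def NoPeriodicGroundStateConfig : Prop :=
  ∃ (C : Type) (_ : Fintype C) (_ : DecidableEq C) (τ : Finset (WangTile C)),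
    (∃ x : ℤ × ℤ → τ, IsGroundStateConfig x) ∧
      ∀ x : ℤ × ℤ → τ, IsGroundStateConfig x → ¬ IsPeriodic x

/-- **Reduction**: Berger's aperiodic tile set yields a finite-range model with ground states but
no periodic ground-state configuration: a periodic ground-state configuration would have zero
energy (`HasZeroEnergy.of_isGroundStateConfig_of_isPeriodic`), i.e. be a periodic tiling.
[cite: Miekisz1998, §2 (p. 3)] [cite: Radin1991, §2d (p. 7)] -/
theorem noPeriodicGroundStateConfig_of_berger (h : Berger1966_aperiodicTileset) :
    NoPeriodicGroundStateConfig := by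
  obtain ⟨C, hC, τ, ⟨x₀, hx₀⟩, hτ⟩ := h
  classical
  have h0 : HasZeroEnergy x₀ := (isTiling_iff_hasZeroEnergy x₀).1 hx₀
  refine ⟨C, hC, inferInstance, τ, ⟨x₀, h0.isGroundStateConfig⟩, fun x hx hxp => ?_⟩
  exact hτ x ((isTiling_iff_hasZeroEnergy x).2 (h0.of_isGroundStateConfig_of_isPeriodic hx hxp)) hxp

/-! ### Non-vacuity of the definitions: a one-tile periodic example -/

/-- The monochromatic tile over `Unit`. [folklore] -/
def monoTile : WangTile Unit := ⟨(), (), (), ()⟩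

/-- The constant configuration by the monochromatic tile is a periodic tiling: tile sets WITH
periodic tilings are the easy case of the trichotomy. [cite: JeandelVanier2020, §1.2 (p. 4)] -/
theorem isTiling_const_monoTile :
    IsTiling (fun _ : ℤ × ℤ => (⟨monoTile, Finset.mem_singleton_self _⟩ : ({monoTile} : Finset _))) ∧
      IsPeriodic (fun _ : ℤ × ℤ => (⟨monoTile, Finset.mem_singleton_self _⟩ : ({monoTile} : Finset _))) :=
  ⟨fun _ _ => ⟨rfl, rfl⟩, ⟨1, one_pos, fun _ _ => ⟨rfl, rfl⟩⟩⟩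

/-! ### Scope boundary at range one: symmetric, direction-independent nearest-neighbour pair
interactions always admit a periodic ground-state configuration -/

section PairGas

variable {A G : Type} [AddCommGroup G] [LinearOrder G] [IsOrderedAddMonoid G]

/-- The **general nearest-neighbour lattice gas** on `ℤ²` with local state space `A` (the `m`
"states per site") and a translation-invariant, possibly DIRECTION-DEPENDENT pair interaction:
`W d a b` is the energy of the bond from a site in state `a` to its neighbour in direction `d` in
state `b` (Radin's optimisation problem (5) for interactions of range one, (8); the mismatch gas of
a tile set is the instance `W = wangInteraction τ`, below). The bond energy at `p` in direction `d`.
[cite: Radin1991, §2c–2d (pp. 5–8) and §3c (8)] -/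
def pairEnergy (W : Dir → A → A → G) (x : ℤ × ℤ → A) (d : Dir) (p : ℤ × ℤ) : G :=
  W d (x p) (x (d.shift p))

/-- The relative Hamiltonian `H(Y, X)` of a local excitation `Y ∼ X` (equal off the finite set `D`)
of the general nearest-neighbour pair gas: the sum over the bonds meeting `D` of the energy
differences. [cite: Miekisz1998, §2 (p. 3)] -/
def pairRelHamiltonian (W : Dir → A → A → G) (D : Finset (ℤ × ℤ)) (y x : ℤ × ℤ → A) : G :=
  ∑ b ∈ bondsMeeting D, (pairEnergy W y b.1 b.2 - pairEnergy W x b.1 b.2)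

/-- Ground-state configurations of the general nearest-neighbour pair gas (Miękisz §2: no local
change lowers the energy). [cite: Miekisz1998, §2 (p. 3)] -/
def IsPairGroundStateConfig (W : Dir → A → A → G) (x : ℤ × ℤ → A) : Prop :=
  ∀ (D : Finset (ℤ × ℤ)) (y : ℤ × ℤ → A), (∀ p ∉ D, y p = x p) → 0 ≤ pairRelHamiltonian W D y x

/-- A configuration all of whose bonds carry the minimal value of the interaction in their
direction is a ground-state configuration (non-frustration: "all interactions attain
simultaneously their minima"). [cite: Miekisz1998, §2 (p. 3, m-potentials)] -/
theorem isPairGroundStateConfig_of_forall_le {W : Dir → A → A → G} {x : ℤ × ℤ → A}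
    (h : ∀ (d : Dir) (p : ℤ × ℤ) (a b : A), pairEnergy W x d p ≤ W d a b) :
    IsPairGroundStateConfig W x := by
  intro D y _
  unfold pairRelHamiltonian
  exact Finset.sum_nonneg fun b _ => sub_nonneg.2 (h b.1 b.2 (y b.2) (y (b.1.shift b.2)))

/-- **The Wang mismatch gas is an instance**: the mismatch indicator of a tile set as a
(direction-dependent, non-symmetric) pair interaction with values in `ℤ`.
[cite: Radin1991, §2d (7)] [cite: Miekisz1998, §1 (p. 2)] -/
def wangInteraction {C : Type} [DecidableEq C] (τ : Finset (WangTile C)) : Dir → τ → τ → ℤ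
  | .horiz, a, b => if a.1.east = b.1.west then 0 else 1
  | .vert, a, b => if a.1.north = b.1.south then 0 else 1

/-- The bond energy of the mismatch gas is the pair energy of `wangInteraction`. [folklore] -/
theorem bondEnergy_eq_pairEnergy {C : Type} [DecidableEq C] {τ : Finset (WangTile C)}
    (x : ℤ × ℤ → τ) (d : Dir) (p : ℤ × ℤ) :
    (bondEnergy x d p : ℤ) = pairEnergy (wangInteraction τ) x d p := by
  cases d <;> simp only [bondEnergy, pairEnergy, wangInteraction] <;> split <;> simp

/-- The relative Hamiltonian of the mismatch gas is that of the pair gas `wangInteraction τ`.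
[folklore] -/
theorem relHamiltonian_eq_pairRelHamiltonian {C : Type} [DecidableEq C] {τ : Finset (WangTile C)}
    (D : Finset (ℤ × ℤ)) (y x : ℤ × ℤ → τ) :
    relHamiltonian D y x = pairRelHamiltonian (wangInteraction τ) D y x := by
  unfold relHamiltonian pairRelHamiltonian
  exact Finset.sum_congr rfl fun b _ => by rw [bondEnergy_eq_pairEnergy, bondEnergy_eq_pairEnergy]

/-- Ground-state configurations of the mismatch gas (`IsGroundStateConfig`) are exactly the
ground-state configurations of the pair gas `wangInteraction τ`: the barrier's models are range-one
pair gases whose interaction is direction-dependent and non-symmetric. [folklore] -/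
theorem isGroundStateConfig_iff_isPairGroundStateConfig {C : Type} [DecidableEq C]
    {τ : Finset (WangTile C)} (x : ℤ × ℤ → τ) :
    IsGroundStateConfig x ↔ IsPairGroundStateConfig (wangInteraction τ) x := by
  simp only [IsGroundStateConfig, IsPairGroundStateConfig, relHamiltonian_eq_pairRelHamiltonian]

/-- The **checkerboard** configuration of two local states (`a` on the even sublattice, `b` on the
odd one); for `a = b` the constant configuration. [folklore] -/
def checkerboard (a b : A) : ℤ × ℤ → A := fun p => if Even (p.1 + p.2) then a else b

/-- The checkerboard is `2`-periodic in both directions. [folklore] -/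
theorem isPeriodic_checkerboard (a b : A) : IsPeriodic (checkerboard a b) := by
  refine ⟨2, two_pos, fun i j => ⟨?_, ?_⟩⟩
  · show (if Even (i + 2 + j) then a else b) = if Even (i + j) then a else b
    rw [show i + 2 + j = i + j + 2 by ring]
    simp [Int.even_add]
  · show (if Even (i + (j + 2)) then a else b) = if Even (i + j) then a else b
    rw [show i + (j + 2) = i + j + 2 by ring]
    simp [Int.even_add]

/-- Every bond of the checkerboard joins a site in state `a` to a site in state `b`, in one order
or the other (`ℤ²` is bipartite). [folklore] -/
theorem checkerboard_bond (a b : A) (d : Dir) (p : ℤ × ℤ) :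
    (checkerboard a b p = a ∧ checkerboard a b (d.shift p) = b) ∨
      (checkerboard a b p = b ∧ checkerboard a b (d.shift p) = a) := by
  have hshift : (d.shift p).1 + (d.shift p).2 = p.1 + p.2 + 1 := by
    cases d <;> simp only [Dir.shift] <;> ring
  by_cases h : Even (p.1 + p.2)
  · left
    refine ⟨by simp [checkerboard, h], ?_⟩
    have h' : ¬ Even ((d.shift p).1 + (d.shift p).2) := by rwa [hshift, Int.even_add_one, not_not]
    simp [checkerboard, h']
  · right
    refine ⟨by simp [checkerboard, h], ?_⟩
    have h' : Even ((d.shift p).1 + (d.shift p).2) := by rwa [hshift, Int.even_add_one]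
    simp [checkerboard, h']

/-- **SCOPE BOUNDARY of the barrier at range one (an evasion, proved).** For ANY finite set of
local states and ANY nearest-neighbour pair interaction on `ℤ²` that is SYMMETRIC
(`V a b = V b a`, identical unlabelled particles) and DIRECTION-INDEPENDENT (the same `V` on
horizontal and vertical bonds, isotropy), a PERIODIC ground-state configuration exists: the
checkerboard of a minimising pair `(a, b)` of `V` puts the minimal bond energy on every bond. Hence
the tile-set examples behind `AperiodicTilingGroundStates` / `NoPeriodicGroundStateConfig`
necessarily use a direction-dependent or non-symmetric coupling (`wangInteraction`), and the escape
closes again from range two/three on: Radin's lattice model with "shapeless" particles and "fully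
symmetric (dependent only on the distance between given particles)" finite-range interactions has a
unique non-periodic ground state, stable under symmetric perturbations of range `< 3`
(Miękisz 1997, §4 Theorem 4, citing Radin, Phys. Lett. 114A (1986)).
[folklore] -/
theorem exists_isPeriodic_isPairGroundStateConfig_of_symmetric [Finite A] [Nonempty A]
    (V : A → A → G) (hV : ∀ a b, V a b = V b a) :
    ∃ x : ℤ × ℤ → A, IsPairGroundStateConfig (fun _ : Dir => V) x ∧ IsPeriodic x := by
  obtain ⟨⟨a, b⟩, hab⟩ := Finite.exists_min (fun q : A × A => V q.1 q.2)
  refine ⟨checkerboard a b, isPairGroundStateConfig_of_forall_le fun d p a' b' => ?_,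
    isPeriodic_checkerboard a b⟩
  show V (checkerboard a b p) (checkerboard a b (d.shift p)) ≤ V a' b'
  rcases checkerboard_bond a b d p with ⟨h1, h2⟩ | ⟨h1, h2⟩
  · rw [h1, h2]; exact hab (a', b')
  · rw [h1, h2, hV b a]; exact hab (a', b')

/-- In particular (symmetric, direction-independent, values in `ℤ` as in this file): the
conclusion of `NoPeriodicGroundStateConfig` — "no ground-state configuration is periodic" — FAILS
for every such interaction. [folklore] -/
theorem not_forall_groundState_aperiodic_of_symmetric [Finite A] [Nonempty A] (V : A → A → ℤ)
    (hV : ∀ a b, V a b = V b a) :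
    ¬ ∀ x : ℤ × ℤ → A, IsPairGroundStateConfig (fun _ : Dir => V) x → ¬ IsPeriodic x := by
  obtain ⟨x, hx, hp⟩ := exists_isPeriodic_isPairGroundStateConfig_of_symmetric V hV
  exact fun h => h x hx hp

end PairGas

end Literature.Barriers.AtomisticToContinuum.WangLatticeGas
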